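/-
Origin: expansion seat `planner-pub-hodgecm-mc-axioms-1-g14-0`, handover #W190 2026-08-20T15:53:55Z md5 a188c3af0e93 (PKG b06c6476fb62 → a188c3af0e93; 159 l.; MECHANICAL (iib-R) rewrite v3.1 of the PKG file as it stands (34 token edits; rules R1x1+RX[h₂']x33)) (`HOME/mc/pub-hodgecm-mc-axioms-1-g14/revendor/kit-r55/stage55/HodgeCM/Model/Sanity/DegenerateClosureR21AE.lean`, md5 a188c3af0e93, 159 lines);
landed by the gen-22 packager (p-g22) in gate run 55 REPLACES the earlier landed copy of `HodgeCM/Model/Sanity/DegenerateClosureR21AE.lean` (seat copy carried the packager Origin header of an earlier run (stripped)).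
-/
/-
Origin: SANITY lane `planner-pub-hodgecm-mc-sanity-1-g11-0` (unit pub-hodgecm-mc-sanity-1-g11, gen 11 of mc-sanity-1,
node SAN-24), 2026-08-20.  NEW additive KERNEL leaf `HodgeCM/Model/Sanity/DegenerateClosureR21AE.lean` over the
RUN-41 row `HodgeCM.Model.E2InstanceR21AE` (glue-1 #371: E revision 21AE = R20AE with row 9 `hsmall` RE-SOURCED to
the common-reflex factorisation `hΘ`, one application of `hsmall_of_commonReflexInput … hR _ hΘ`, 15 binders, same
conclusion) and the installed RUN-40 leaves `HodgeCM.Model.Sanity.CommonReflexDegenerate` (SAN-22: `hTheta_degS`, the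
row `hΘ` is FREE over collapsed theta sets) and `HodgeCM.Model.Sanity.DegenerateClosureR20AE` (SAN-23: the degenerate
closure of R20AE).  Imported by nothing.
CONDITIONAL ROW: tabled only together with #371; INSTALL AFTER #371 (and after SAN-22 / SAN-23, installed RUN 40).
KERNEL: 0 records, 0 `Prop` definitions, 0 `def`s, 0 hypotheses minted, nothing cited, no instances.
Expected `#print axioms`: ⊆ {propext, Classical.choice, Quot.sound}.
-/
import Summits.HodgeConjecture.HodgeCM.Model.E2InstanceR21AE
import Summits.HodgeConjecture.HodgeCM.Model.Sanity.CommonReflexDegenerate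
import Summits.HodgeConjecture.HodgeCM.Model.Sanity.DegenerateClosureR20AE

/-!
# SAN-24 — the DEGENERATE CLOSURE of E R21AE (row 9 re-sourced: `hsmall ↦ hΘ`)

MODEL-CONSTRUCTION sub-cell, SANITY lane (unit `pub-hodgecm-mc-sanity-1-g11`, node SAN-24).  KERNEL only; census leaf.

Revision 21AE (RUN 41, glue-1 #371 `Model.perL_picardCM_r21AE`) is `Model.perL_picardCM_r20AE` with binder group 7
`hsmall` («theta classes at small level lie in `U_iso(Γ; M, Ψ_i^M, σ')` for some CM extension of the corner») replaced
by the print-nearer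

  `hΘ : ∀ V c, GoodCtx → [c.K : ℚ] = 6 → ∀ i, ∃ Γ₀, ∀ Γ ≤ Γ₀, ∃ D : CommonReflexInput c.K (c.Ψ i) c.σ,
        Θ_i(Γ) ⊆ span_ℂ (D.surfaceClasses Γ)`

(mc-axioms-1's RUN-38 junction #363; content word model1 STATUS l.12522), discharged into `hsmall` in kernel by
`hsmall_of_commonReflexInput … hR _ hΘ`.  SAN-22 already recorded that `hΘ` is FREE over the degenerate data
(`hTheta_degS`: over `S := degS` every theta set collapses to `{0}` — SAN-11 `theta_thetaModelOf_degS_eq` — and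
`0 ∈ span`, with the SELF datum `selfCommonReflexInput` built from the universe parameter (iii) alone).  This file
records the degenerate census of the revision:

* `hTheta_degS_row` — SAN-22 `hTheta_degS` in the exact binder shape of R21AE's group 7 at `S := degS`,
  `W := zeroSK ∘ W` (the `GoodCtx` and degree hypotheses are not used).
* `perL_r21AE_degS` — E R21AE at `S := degS`, `W := zeroSK ∘ W` closes `(picardCMUniverse …).PerL` from `h hA W μ hR`
  and the ONE binder `CdegS`; group 7 by `hTheta_degS_row`, the other seven Prop-row discharges VERBATIM those of
  SAN-23 `perL_r20AE_degS` (`hT` SAN-17a, `hpd` / along-form `hk` vacuous over the empty `C`-fibre SAN-10b, `gen12`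
  `gen12_degS'`, `real34` / `hyp12` / `hyp34` SAN-12).
* `perL_r21AE_degS_eq` — over the degenerate data the R21AE closure and SAN-23's R20AE closure are one proposition
  proved along the two revisions (`rfl`).
* `perL_r21AE_of_noGoodSextic` — so R21AE, like every revision since R10, closes from toys EXACTLY modulo the vacuity
  residual `NoGoodSextic` (refuted in kernel: SAN-15b `not_noGoodSextic`).

READING (census, MODEL-N ±0; nothing here is a defect claim): the re-sourcing moves row 9's content from a `U_iso`
membership to a span inclusion against Liu's realised common-reflex surface classes; at an honest pin both are
conditions on genuine theta classes, over degenerate data both are free (SAN-20 `hsmall_degS` needed `GoodCtx` and the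
self extension; `hΘ` needs nothing but the collapse).  So the degenerate census of record is UNCHANGED by the move
`_r20AE → _r21AE`: every binder of E but `C` free, `C` (`CdegS`, empty by SAN-15b) the sole gatekeeper; toy-visible
binders 15 → 15.
-/

set_option autoImplicit false

noncomputable section

namespace HodgeCM
namespace Model
namespace Sanity

open HodgeCM.Universe (SideData ThetaModel AdelicThetaCore AdelicTorusCore)
open HodgeCM.PerL34 HodgeCM.PerL34.ArchC
open Literature.AlgebraicGeometry.HodgeTheory Literature.NumberTheory.Automorphic.PicardCM
open Literature.NumberTheory.Transcendental (Arapura2012_Cor_15_4_6)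
open Literature.AlgebraicGeometry.ShimuraVarieties
open HodgeCM.Model.ThetaSpace
open HodgeCM.Model.SupplyResidual

variable (hHD : exists_isReal_hodgeModel) (hI : hodgePQ_independent_of_hodgeModel)
  (h₁ : BallQuotientUniformised)

/-- **Row 9 of R21AE (`hΘ`) is free over the degenerate data** — SAN-22 `hTheta_degS` in E's binder shape at
`S := degS`, `W := zeroSK ∘ W` (the two hypotheses `GoodCtx`, `[c.K : ℚ] = 6` are discarded). -/
theorem hTheta_degS_row (h₃ : CMAbelianVarietyRealised) (h : Bool) (hA : Arapura2012_Cor_15_4_6)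
    (W : ∀ {L : CMField} {ι₁ : L →+* ℂ} (V : HermSpace3 L ι₁) (c : SeesawCtx L), WmInput V c.D)
    (μ : ∀ {L : CMField}, SeesawCtx L → Fin 4 → NumberField.InfinitePlace L → ℤ)
    {L : CMField} {ι₁ : L →+* ℂ} (V : HermSpace3 L ι₁) (c : SeesawCtx L) :
    (thetaModelOf hHD hI h₁ h₃ h (embOf hHD hI h₁ h₃) (coverOf hHD hI h₁ h₃ hA)
        (wmOfInput fun V c => (W V c).zeroSK)
        (thetaOf _ (thetaClassInputOf _ (fun V c => thetaSpaceInputOf hHD hI h₁ h₃ degS V c))) (d12Of μ)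
        (d34Of μ)).GoodCtx ι₁ c → Module.finrank ℚ c.K = 6 →
      ∀ i : Fin 4, ∃ Γ₀ : Level V, ∀ Γ ≤ Γ₀,
        ∃ D : CommonReflexInput c.K (c.Ψ i) c.σ,
          (thetaModelOf hHD hI h₁ h₃ h (embOf hHD hI h₁ h₃) (coverOf hHD hI h₁ h₃ hA)
              (wmOfInput fun V c => (W V c).zeroSK)
              (thetaOf _ (thetaClassInputOf _ (fun V c => thetaSpaceInputOf hHD hI h₁ h₃ degS V c))) (d12Of μ)
              (d34Of μ)).Theta V c i Γ ⊆ Submodule.span ℂ (D.surfaceClasses hHD hI h₁ h₃ V Γ) :=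
  fun _ _ i => hTheta_degS hHD hI h₁ h₃ h (embOf hHD hI h₁ h₃) (coverOf hHD hI h₁ h₃ hA)
    (wmOfInput fun V c => (W V c).zeroSK) (d12Of μ) (d34Of μ) V c i

/-- **E R21AE over the degenerate data closes PerL modulo the single binder `C`** — group 7 `hΘ` by SAN-22
(`hTheta_degS_row`), every other Prop-row discharge VERBATIM as in SAN-23 `perL_r20AE_degS`. -/
theorem perL_r21AE_degS (h₃' : CMAbelianVarietyEigenbasisRealised) (h : Bool)
    (hA : Arapura2012_Cor_15_4_6)
    (W : ∀ {L : CMField} {ι₁ : L →+* ℂ} (V : HermSpace3 L ι₁) (c : SeesawCtx L), WmInput V c.D)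
    (μ : ∀ {L : CMField}, SeesawCtx L → Fin 4 → NumberField.InfinitePlace L → ℤ)
    (hR : DeligneMilne1982_Thm_6_20_full)
    (C : CdegS hHD hI h₁ (cmAbelianVarietyRealised_of_eigenbasis hHD hI h₃') h hA W μ) :
    (picardCMUniverse hHD hI h₁ (cmAbelianVarietyRealised_of_eigenbasis hHD hI h₃')).PerL := by
  refine perL_picardCM_r21AE hHD hI h₁ h₃' h hA (fun V c => (W V c).zeroSK) degS μ hR
    ?_ C ?_ ?_ ?_ ?_ ?_ ?_ ?_
  · -- `hΘ` (row 9 re-sourced) — SAN-22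
    intro L ι₁ V c hc hK i
    exact hTheta_degS_row hHD hI h₁ _ h hA W μ V c hc hK i
  · -- `hT`
    intro L ι₁ V c k N
    exact isThetaArchContinuous_degS V c k N
  · -- `hpd`
    intro L ι₁ V c hV hc h6 k hk N hN
    exact ((isEmpty_C_fibre_degS hHD hI h₁ _ V c hV).false (C V c hV hc h6)).elim
  · -- `hk` (along form)
    intro L ι₁ V c hV hc h6 k hk N hN p
    exact ((isEmpty_C_fibre_degS hHD hI h₁ _ V c hV).false (C V c hV hc h6)).elim
  · -- `gen12`
    intro L ι₁ V c
    exact gen12_degS' hHD hI h₁ _ h (embOf hHD hI h₁ _) (coverOf hHD hI h₁ _ hA)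
      (fun V c => (W V c).zeroSK) μ V c
  · -- `real34`
    intro L ι₁ V c _ _
    exact real34_zeroSK (embOf hHD hI h₁ _) (coverOf hHD hI h₁ _ hA) W _ h (d12Of μ) (d34Of μ) V c
  · -- `hyp12`
    intro L ι₁ V c _ _
    exact hyp12_zeroSK (embOf hHD hI h₁ _) (coverOf hHD hI h₁ _ hA) W _ h _ _ _ V c
  · -- `hyp34`
    intro L ι₁ V c _ _
    exact hyp34_zeroSK (embOf hHD hI h₁ _) (coverOf hHD hI h₁ _ hA) W _ h _ _ _ V c

/-- The R21AE closure and SAN-23's R20AE closure over the degenerate data are ONE proposition, proved along the two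
revisions (proof irrelevance, recorded so that the census of record reads the same from either E term). -/
theorem perL_r21AE_degS_eq (h₃' : CMAbelianVarietyEigenbasisRealised) (h : Bool)
    (hA : Arapura2012_Cor_15_4_6)
    (W : ∀ {L : CMField} {ι₁ : L →+* ℂ} (V : HermSpace3 L ι₁) (c : SeesawCtx L), WmInput V c.D)
    (μ : ∀ {L : CMField}, SeesawCtx L → Fin 4 → NumberField.InfinitePlace L → ℤ)
    (hR : DeligneMilne1982_Thm_6_20_full)
    (C : CdegS hHD hI h₁ (cmAbelianVarietyRealised_of_eigenbasis hHD hI h₃') h hA W μ) :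
    perL_r21AE_degS hHD hI h₁ h₃' h hA W μ hR C = perL_r20AE_degS hHD hI h₁ h₃' h hA W μ hR C :=
  rfl

/-- **E R21AE closes from the degenerate data EXACTLY modulo the vacuity residual `NoGoodSextic`** (cf. SAN-23
`perL_r20AE_of_noGoodSextic`; the residual is refuted by SAN-15b `not_noGoodSextic`). -/
theorem perL_r21AE_of_noGoodSextic (h₃' : CMAbelianVarietyEigenbasisRealised) (h : Bool)
    (hA : Arapura2012_Cor_15_4_6)
    (W : ∀ {L : CMField} {ι₁ : L →+* ℂ} (V : HermSpace3 L ι₁) (c : SeesawCtx L), WmInput V c.D)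
    (μ : ∀ {L : CMField}, SeesawCtx L → Fin 4 → NumberField.InfinitePlace L → ℤ)
    (hR : DeligneMilne1982_Thm_6_20_full)
    (hno : NoGoodSextic hHD hI h₁ (cmAbelianVarietyRealised_of_eigenbasis hHD hI h₃') h hA W μ) :
    (picardCMUniverse hHD hI h₁ (cmAbelianVarietyRealised_of_eigenbasis hHD hI h₃')).PerL :=
  perL_r21AE_degS hHD hI h₁ h₃' h hA W μ hR fun V c hV hc h6 => (hno V c hV hc h6).elim

end Sanity
end Model
end HodgeCM

end
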